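import Mathlib
import Summits.KontsevichZagierPeriods.Zeta5Search.HarmonicResidue
import Summits.KontsevichZagierPeriods.Zeta5Search.ResidueIdentityProof
import Summits.KontsevichZagierPeriods.Zeta5Search.PadicThirdOrder
import HarnessLib

/-!
# ζ(5) search — harmonic sums modulo `p²`: WOLSTENHOLME and the prime-to-`p` harmonic sums to second order (tools for (V3))

Cell `pub-zeta5` (HONEST FRAMING: systematic search; no irrationality claim unless certified), typer seat generation 12.
Elementary congruences used by the THIRD digit of the constant-term piece `V_x` (`ThirdDigitVProof.lean`, REPORT-gen2-g10 §6.2 (V3):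
"`S₁ := Σ_{0<i<p} 1/i ≡ 0 (mod p²)`, `pS₂ ≡ 0 (mod p²)` (`p ≥ 5`) dispose of the cross terms between levels"), `p ≥ 5` prime:
* `padicNorm_harm2_pred_le` — **`H^{(2)}_{p−1} ≡ 0 (mod p)`** (in `ZMod p`: `Σ_{a ≠ 0} a⁻² = Σ_a a^{p−3} = 0` since `0 < p − 3 < p − 1`);
* `padicNorm_harm_pred_le_two` — **WOLSTENHOLME: `H_{p−1} ≡ 0 (mod p²)`** (`2H_{p−1} = p·Σ_j 1/((j+1)(p−1−j))` and the sum is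
  `≡ −H^{(2)}_{p−1} ≡ 0 (mod p)`);
* `padicNorm_harmN2_sub_le` — `N_{s,2} := H^{(2)}_s − p^{−2}H^{(2)}_{⌊s/p⌋} ≡ H^{(2)}_{s mod p} (mod p)`;
* `padicNorm_harmN1_sub_le₂` — **`N_{s,1} := H_s − p^{−1}H_{⌊s/p⌋} ≡ H_{s mod p} − ⌊s/p⌋·p·H^{(2)}_{s mod p} (mod p²)`**
  (induction on `s`: inside a block `1/(ℓp + u) ≡ 1/u − ℓp/u² (mod p²)`; each completed block adds `H_{p−1} − (m−1)pH^{(2)}_{p−1} ≡ 0`).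
`p`-adic norms of rational numbers; nothing here concerns irrationality.
-/

noncomputable section

open Finset

namespace Summit.KontsevichZagierPeriods.Zeta5Search.SecondOrder

open Summit.KontsevichZagierPeriods.Zeta5Search.PadicSeries
open Summit.KontsevichZagierPeriods.Zeta5Search.ClusterValuation (PInt.intCast PInt.zpow_int PInt.cast_zpow_int PInt.sum PInt.cast_sum
  PInt.pCong_of_cast_eq_zero pCong padicNorm_le_of_val)
open Summit.KontsevichZagierPeriods.Zeta5Search.CellA (padicNorm_p padicNorm_inv_sub_inv_le harm_succ padicNorm_harm_le_one padicNorm_pow_eq)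
open Summit.KontsevichZagierPeriods.Zeta5Search.ResidueLaw (sum_range_erase_eq_sum_univ_erase)
open Literature.NumberTheory.Transcendental.BallRivoal (harm)

variable {p : ℕ} [hp : Fact p.Prime]

/-! ### `H^{(2)}_{p−1} ≡ 0 (mod p)` -/

/-- In `ZMod p` (`p ≥ 5`): `Σ_{a ≠ 0} a^{−2} = 0`. -/
theorem sum_univ_erase_zpow_neg_two (hp5 : 5 ≤ p) : ∑ a ∈ (univ : Finset (ZMod p)).erase 0, a ^ (-(2 : ℤ)) = 0 := by
  have hcard : Fintype.card (ZMod p) = p := ZMod.card p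
  -- `a^{-2} = a^{p-3}` for `a ≠ 0`
  have hconv : ∀ a ∈ (univ : Finset (ZMod p)).erase 0, a ^ (-(2 : ℤ)) = a ^ (p - 3) := by
    intro a ha
    have ha0 : a ≠ 0 := (mem_erase.1 ha).1
    have hF : a ^ (p - 1) = 1 := ZMod.pow_card_sub_one_eq_one ha0
    have e : a ^ (p - 3) * a ^ 2 = 1 := by rw [← pow_add, show p - 3 + 2 = p - 1 by omega, hF]
    rw [show (-(2 : ℤ)) = -((2 : ℕ) : ℤ) by norm_num, zpow_neg, zpow_natCast]
    exact (eq_inv_of_mul_eq_one_left e).symm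
  rw [sum_congr rfl hconv, sum_erase_eq_sub (mem_univ _), zero_pow (by omega), sub_zero]
  exact FiniteField.sum_pow_lt_card_sub_one (K := ZMod p) (p - 3) (by rw [hcard]; omega)

/-- **`H^{(2)}_{p−1} ≡ 0 (mod p)`** for a prime `p ≥ 5`. -/
theorem padicNorm_harm2_pred_le (hp5 : 5 ≤ p) : padicNorm p (harm 2 (p - 1)) ≤ (p : ℚ) ^ (-(1 : ℤ)) := by
  have hp1 := hp.out.one_lt
  -- the terms as integer powers of integers prime to `p`
  have hterm : ∀ m : ℕ, (1 : ℚ) / ((m : ℚ) + 1) ^ 2 = (((m + 1 : ℕ) : ℤ) : ℚ) ^ (-(2 : ℤ)) := by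
    intro m
    rw [show (-(2 : ℤ)) = -((2 : ℕ) : ℤ) by norm_num, zpow_neg, zpow_natCast, one_div]
    push_cast; ring
  have hunit : ∀ m ∈ range (p - 1), ¬ (p : ℤ) ∣ ((m + 1 : ℕ) : ℤ) := by
    intro m hm h
    have hm' := mem_range.1 hm
    have := Int.le_of_dvd (by push_cast; omega) h
    push_cast at this; omega
  have hden : ∀ m ∈ range (p - 1), ¬ p ∣ ((1 : ℚ) / ((m : ℚ) + 1) ^ 2).den := by
    intro m hm; rw [hterm m]; exact PInt.zpow_int (hunit m hm) _
  have hdenS : ¬ p ∣ (harm 2 (p - 1)).den := by rw [harm]; exact PInt.sum hden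
  have hcast : ((harm 2 (p - 1) : ℚ) : ZMod p) = 0 := by
    rw [harm, PInt.cast_sum hden]
    have h1 : ∀ m ∈ range (p - 1), (((1 : ℚ) / ((m : ℚ) + 1) ^ 2 : ℚ) : ZMod p) = (((m + 1 : ℕ) : ℕ) : ZMod p) ^ (-(2 : ℤ)) := by
      intro m hm
      rw [hterm m, PInt.cast_zpow_int (hunit m hm), Int.cast_natCast]
    rw [sum_congr rfl h1]
    -- reindex `m ↦ m + 1 : range (p-1) → (range p).erase 0 → univ.erase 0`
    have h2 : ∑ m ∈ range (p - 1), (((m + 1 : ℕ) : ℕ) : ZMod p) ^ (-(2 : ℤ)) =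
        ∑ y ∈ (range p).erase 0, ((y : ℕ) : ZMod p) ^ (-(2 : ℤ)) := by
      have h3 : (range p).erase 0 = Ico 1 p := by
        ext y; simp only [Finset.mem_erase, Finset.mem_range, Finset.mem_Ico]; omega
      rw [h3, Finset.sum_Ico_eq_sum_range]
      refine sum_congr (by rw [show p - 1 = p - 1 from rfl]) fun m _ => by rw [add_comm]
    rw [h2, sum_range_erase_eq_sum_univ_erase (fun z : ZMod p => z ^ (-(2 : ℤ))) hp.out.pos, Nat.cast_zero]
    exact sum_univ_erase_zpow_neg_two hp5
  have h := PInt.pCong_of_cast_eq_zero hdenS hcast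
  rw [pCong, decide_eq_true_iff] at h
  exact padicNorm_le_of_val fun hne => h.resolve_left hne

/-! ### Wolstenholme: `H_{p−1} ≡ 0 (mod p²)` -/

/-- **WOLSTENHOLME'S THEOREM** (`p ≥ 5`): `‖H_{p−1}‖_p ≤ p⁻²`. -/
theorem padicNorm_harm_pred_le_two (hp5 : 5 ≤ p) : padicNorm p (harm 1 (p - 1)) ≤ (p : ℚ) ^ (-(2 : ℤ)) := by
  have h1p := hp.out.one_lt
  have hp2 : p ≠ 2 := by omega
  have hp0 : (p : ℚ) ≠ 0 := Nat.cast_ne_zero.2 hp.out.ne_zero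
  have htwo : padicNorm p (2 : ℚ) = 1 := padicNorm_two hp2
  -- units
  have hu1 : ∀ j ∈ range (p - 1), padicNorm p ((j : ℚ) + 1) = 1 := by
    intro j hj
    have hj' := mem_range.1 hj
    have e : ((j : ℚ) + 1) = ((j + 1 : ℕ) : ℚ) := by push_cast; ring
    rw [e]
    have := (padicNorm.nat_eq_one_iff (p := p) (j + 1)).2 (fun h => by have := Nat.le_of_dvd (by omega) h; omega)
    exact_mod_cast this
  have hu2 : ∀ j ∈ range (p - 1), padicNorm p ((p : ℚ) - 1 - j) = 1 := by
    intro j hj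
    have hj' := mem_range.1 hj
    have e : ((p : ℚ) - 1 - j) = ((p - 1 - j : ℕ) : ℚ) := by
      rw [Nat.cast_sub (by omega), Nat.cast_sub h1p.le]; push_cast; ring
    rw [e]
    have := (padicNorm.nat_eq_one_iff (p := p) (p - 1 - j)).2 (fun h => by have := Nat.le_of_dvd (by omega) h; omega)
    exact_mod_cast this
  -- `2 H_{p-1} = p · T` with `T = Σ_j 1/((j+1)(p-1-j))`
  set T := ∑ j ∈ range (p - 1), 1 / (((j : ℚ) + 1) * ((p : ℚ) - 1 - j)) with hT
  have hrefl : harm 1 (p - 1) = ∑ j ∈ range (p - 1), 1 / ((p : ℚ) - 1 - j) := by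
    rw [harm, ← sum_range_reflect]
    refine sum_congr rfl fun j hj => ?_
    have hj' := mem_range.1 hj
    rw [pow_one, Nat.cast_sub (by omega), Nat.cast_sub (by omega), Nat.cast_sub h1p.le]
    push_cast; ring
  have hsum : 2 * harm 1 (p - 1) = (p : ℚ) * T := by
    have h2 : 2 * harm 1 (p - 1) = harm 1 (p - 1) + ∑ j ∈ range (p - 1), 1 / ((p : ℚ) - 1 - j) := by
      rw [two_mul, ← hrefl]
    rw [h2, harm, ← sum_add_distrib, hT, mul_sum]
    refine sum_congr rfl fun j hj => ?_
    have h1 : ((j : ℚ) + 1) ≠ 0 := fun h => by have := hu1 j hj; rw [h, padicNorm.zero] at this; exact zero_ne_one this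
    have h2 : ((p : ℚ) - 1 - j) ≠ 0 := fun h => by have := hu2 j hj; rw [h, padicNorm.zero] at this; exact zero_ne_one this
    rw [pow_one]; field_simp; ring
  -- `T ≡ −H^{(2)}_{p-1} (mod p)` termwise: `1/((j+1)(p-1-j)) + 1/(j+1)² = p/((j+1)²(p-1-j))`
  have hTH : padicNorm p (T + harm 2 (p - 1)) ≤ (p : ℚ) ^ (-(1 : ℤ)) := by
    rw [hT, harm, ← sum_add_distrib]
    refine padicNorm.sum_le' (fun j hj => ?_) (zpow_p_nonneg _)
    have h1 : ((j : ℚ) + 1) ≠ 0 := fun h => by have := hu1 j hj; rw [h, padicNorm.zero] at this; exact zero_ne_one this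
    have h2 : ((p : ℚ) - 1 - j) ≠ 0 := fun h => by have := hu2 j hj; rw [h, padicNorm.zero] at this; exact zero_ne_one this
    have e : 1 / (((j : ℚ) + 1) * ((p : ℚ) - 1 - j)) + 1 / ((j : ℚ) + 1) ^ 2 =
        (p : ℚ) / (((j : ℚ) + 1) ^ 2 * ((p : ℚ) - 1 - j)) := by
      field_simp; ring
    rw [e, padicNorm.div, padicNorm.mul, padicNorm_pow_eq, hu1 j hj, hu2 j hj, one_pow, one_mul, div_one, padicNorm_p]
  have hTn : padicNorm p T ≤ (p : ℚ) ^ (-(1 : ℤ)) := by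
    have e : T = (T + harm 2 (p - 1)) - harm 2 (p - 1) := by ring
    rw [e]
    exact (padicNorm.sub (p := p)).trans (max_le hTH (padicNorm_harm2_pred_le hp5))
  have e : harm 1 (p - 1) = (p : ℚ) * T / 2 := by rw [← hsum]; ring
  rw [e, padicNorm.div, htwo, div_one, padicNorm.mul, padicNorm_p]
  calc (p : ℚ) ^ (-(1 : ℤ)) * padicNorm p T ≤ (p : ℚ) ^ (-(1 : ℤ)) * (p : ℚ) ^ (-(1 : ℤ)) :=
        mul_le_mul_of_nonneg_left hTn (zpow_p_nonneg _)
    _ = (p : ℚ) ^ (-(2 : ℤ)) := by rw [← zpow_add₀ hp0]; norm_num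

/-! ### The prime-to-`p` harmonic sums -/

/-- Successor bookkeeping at a multiple of `p`: if `p ∣ s + 1 = mp` then `⌊s/p⌋ = m − 1`, `(m : ℚ) = ⌊s/p⌋ + 1`, `s + 1 = p·m`. -/
theorem div_of_dvd_succ {s m : ℕ} (hm : s + 1 = p * m) :
    0 < m ∧ s / p = m - 1 ∧ ((s : ℚ) + 1) = (p : ℚ) * m ∧ (((s / p : ℕ) : ℚ) + 1) = m := by
  have hp1 := hp.out.one_lt
  have hm0 : 0 < m := by
    rcases Nat.eq_zero_or_pos m with rfl | h
    · omega
    · exact h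
  have hdiv : (s / p : ℕ) = m - 1 := by
    have : s = p * (m - 1) + (p - 1) := by
      zify [hp1.le, hm0] at hm ⊢
      linarith
    rw [this, Nat.mul_add_div hp.out.pos, Nat.div_eq_of_lt (by omega)]
    omega
  refine ⟨hm0, hdiv, by exact_mod_cast hm, ?_⟩
  rw [hdiv]; push_cast [Nat.cast_sub hm0]; ring

/-- The residue step: `s + 1 = p·⌊s/p⌋ + (s mod p + 1)` in `ℚ`, with `‖p·⌊s/p⌋‖ ≤ p⁻¹`. -/
theorem succ_eq_residue_add_level (s : ℕ) :
    ((s : ℚ) + 1) = ((((s % p : ℕ) : ℚ)) + 1) + (p : ℚ) * ((s / p : ℕ) : ℚ) ∧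
      padicNorm p ((p : ℚ) * ((s / p : ℕ) : ℚ)) ≤ (p : ℚ) ^ (-(1 : ℤ)) := by
  refine ⟨?_, ?_⟩
  · have h := Nat.div_add_mod s p
    have e3 : ((s : ℚ)) = (p : ℚ) * ((s / p : ℕ) : ℚ) + ((s % p : ℕ) : ℚ) := by exact_mod_cast h.symm
    rw [e3]; ring
  · rw [padicNorm.mul, padicNorm_p]
    calc (p : ℚ) ^ (-(1 : ℤ)) * padicNorm p ((s / p : ℕ) : ℚ) ≤ (p : ℚ) ^ (-(1 : ℤ)) * 1 :=
          mul_le_mul_of_nonneg_left (by simpa using padicNorm.of_nat (p := p) (s / p)) (zpow_p_nonneg _)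
      _ = _ := mul_one _

/-- The residue `s mod p + 1` is a `p`-adic unit when `p ∤ s + 1`. -/
theorem padicNorm_residue_succ_eq_one {s : ℕ} (hdvd : ¬ p ∣ s + 1) : padicNorm p ((((s % p : ℕ) : ℚ)) + 1) = 1 := by
  have hp1 := hp.out.one_lt
  have hs1 := (succ_mod_cases (p := p) hp1).2 hdvd
  have hr : s % p + 1 < p := by have := Nat.mod_lt (s + 1) (by omega : 0 < p); omega
  have e1 : ((((s % p : ℕ) : ℚ)) + 1) = ((s % p + 1 : ℕ) : ℚ) := by push_cast; ring
  rw [e1]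
  exact_mod_cast (padicNorm.nat_eq_one_iff (p := p) (s % p + 1)).2
    (fun h => by have := Nat.le_of_dvd (by omega) h; omega)

/-- **`N_{s,2} ≡ H^{(2)}_{s mod p} (mod p)`** (`p ≥ 5`). -/
theorem padicNorm_harmN2_sub_le (hp5 : 5 ≤ p) (s : ℕ) :
    padicNorm p (harm 2 s - harm 2 (s / p) / (p : ℚ) ^ 2 - harm 2 (s % p)) ≤ (p : ℚ) ^ (-(1 : ℤ)) := by
  have hp1 := hp.out.one_lt
  have hp0 : (p : ℚ) ≠ 0 := Nat.cast_ne_zero.2 hp.out.ne_zero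
  have h00 : harm 2 0 = 0 := by simp [harm]
  induction s with
  | zero =>
    rw [Nat.zero_div, Nat.zero_mod, h00, zero_div, sub_zero, sub_zero, padicNorm.zero]; exact zpow_p_nonneg _
  | succ s ih =>
    rw [Nat.succ_div, harm_succ]
    by_cases hdvd : p ∣ s + 1
    · obtain ⟨hsm, hs0⟩ := (succ_mod_cases (p := p) hp1).1 hdvd
      rw [if_pos hdvd, harm_succ, hs0, h00, sub_zero]
      obtain ⟨m, hm⟩ := hdvd
      obtain ⟨hm0, hdiv, hs1, hm1⟩ := div_of_dvd_succ (p := p) hm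
      have e : harm 2 s + 1 / ((s : ℚ) + 1) ^ 2 - (harm 2 (s / p) + 1 / (((s / p : ℕ) : ℚ) + 1) ^ 2) / (p : ℚ) ^ 2 =
          (harm 2 s - harm 2 (s / p) / (p : ℚ) ^ 2 - harm 2 (s % p)) + harm 2 (p - 1) := by
        have hmq : (m : ℚ) ≠ 0 := by exact_mod_cast hm0.ne'
        rw [hs1, hm1, hsm]
        field_simp
        ring
      rw [e]
      exact (padicNorm.nonarchimedean (p := p)).trans (max_le ih (padicNorm_harm2_pred_le hp5))
    · have hs1 := (succ_mod_cases (p := p) hp1).2 hdvd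
      rw [if_neg hdvd, add_zero, hs1, harm_succ]
      have e : harm 2 s + 1 / ((s : ℚ) + 1) ^ 2 - harm 2 (s / p) / (p : ℚ) ^ 2 -
          (harm 2 (s % p) + 1 / (((s % p : ℕ) : ℚ) + 1) ^ 2) =
          (harm 2 s - harm 2 (s / p) / (p : ℚ) ^ 2 - harm 2 (s % p)) +
            (1 / (((((s % p : ℕ) : ℚ)) + 1) + (p : ℚ) * ((s / p : ℕ) : ℚ)) ^ 2 - 1 / ((((s % p : ℕ) : ℚ)) + 1) ^ 2) := by
        rw [(succ_eq_residue_add_level (p := p) s).1]; ring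
      rw [e]
      refine (padicNorm.nonarchimedean (p := p)).trans (max_le ih ?_)
      exact padicNorm_div_sq_sub_le (by rw [padicNorm.one]) (padicNorm_residue_succ_eq_one hdvd)
        (succ_eq_residue_add_level (p := p) s).2

/-- **`N_{s,1} ≡ H_{s mod p} − ⌊s/p⌋·p·H^{(2)}_{s mod p} (mod p²)`** (`p ≥ 5`; Wolstenholme enters at every completed block). -/
theorem padicNorm_harmN1_sub_le₂ (hp5 : 5 ≤ p) (s : ℕ) :
    padicNorm p (harm 1 s - harm 1 (s / p) / (p : ℚ) ^ 1
      - (harm 1 (s % p) - ((s / p : ℕ) : ℚ) * p * harm 2 (s % p))) ≤ (p : ℚ) ^ (-(2 : ℤ)) := by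
  have hp1 := hp.out.one_lt
  have hp0 : (p : ℚ) ≠ 0 := Nat.cast_ne_zero.2 hp.out.ne_zero
  have h00 : harm 1 0 = 0 := by simp [harm]
  have h002 : harm 2 0 = 0 := by simp [harm]
  induction s with
  | zero =>
    rw [Nat.zero_div, Nat.zero_mod, h00, h002, zero_div, sub_zero, mul_zero, sub_zero, sub_zero, padicNorm.zero]
    exact zpow_p_nonneg _
  | succ s ih =>
    rw [Nat.succ_div, harm_succ]
    by_cases hdvd : p ∣ s + 1
    · obtain ⟨hsm, hs0⟩ := (succ_mod_cases (p := p) hp1).1 hdvd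
      rw [if_pos hdvd, harm_succ, hs0, h00, h002, mul_zero, sub_zero, sub_zero]
      obtain ⟨m, hm⟩ := hdvd
      obtain ⟨hm0, hdiv, hs1, hm1⟩ := div_of_dvd_succ (p := p) hm
      have e : harm 1 s + 1 / ((s : ℚ) + 1) ^ 1 - (harm 1 (s / p) + 1 / (((s / p : ℕ) : ℚ) + 1) ^ 1) / (p : ℚ) ^ 1 =
          (harm 1 s - harm 1 (s / p) / (p : ℚ) ^ 1 - (harm 1 (s % p) - ((s / p : ℕ) : ℚ) * p * harm 2 (s % p)))
            + (harm 1 (p - 1) - ((s / p : ℕ) : ℚ) * p * harm 2 (p - 1)) := by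
        have hmq : (m : ℚ) ≠ 0 := by exact_mod_cast hm0.ne'
        rw [hs1, hm1, hsm]
        field_simp
        ring
      rw [e]
      refine (padicNorm.nonarchimedean (p := p)).trans (max_le ih ((padicNorm.sub (p := p)).trans (max_le
        (padicNorm_harm_pred_le_two hp5) ?_)))
      rw [padicNorm.mul, padicNorm.mul, padicNorm_p]
      calc padicNorm p ((s / p : ℕ) : ℚ) * (p : ℚ) ^ (-(1 : ℤ)) * padicNorm p (harm 2 (p - 1))
          ≤ 1 * (p : ℚ) ^ (-(1 : ℤ)) * (p : ℚ) ^ (-(1 : ℤ)) :=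
            mul_le_mul (mul_le_mul_of_nonneg_right (by simpa using padicNorm.of_nat (p := p) (s / p)) (zpow_p_nonneg _))
              (padicNorm_harm2_pred_le hp5) (padicNorm.nonneg _) (by positivity)
        _ = (p : ℚ) ^ (-(2 : ℤ)) := by rw [one_mul, ← zpow_add₀ hp0]; norm_num
    · have hs1 := (succ_mod_cases (p := p) hp1).2 hdvd
      rw [if_neg hdvd, add_zero, hs1, harm_succ, harm_succ]
      obtain ⟨hdec, ht⟩ := succ_eq_residue_add_level (p := p) s
      set u : ℚ := ((((s % p : ℕ) : ℚ)) + 1) with hu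
      set t : ℚ := (p : ℚ) * ((s / p : ℕ) : ℚ) with htdef
      have e : harm 1 s + 1 / ((s : ℚ) + 1) ^ 1 - harm 1 (s / p) / (p : ℚ) ^ 1 -
          (harm 1 (s % p) + 1 / u ^ 1 - ((s / p : ℕ) : ℚ) * p * (harm 2 (s % p) + 1 / u ^ 2)) =
          (harm 1 s - harm 1 (s / p) / (p : ℚ) ^ 1 - (harm 1 (s % p) - ((s / p : ℕ) : ℚ) * p * harm 2 (s % p)))
            + (1 / (u + t) - (1 / u - t * (1 / u ^ 2))) := by
        rw [hdec, htdef]; ring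
      rw [e]
      refine (padicNorm.nonarchimedean (p := p)).trans (max_le ih ?_)
      exact padicNorm_div_add_sub_le (by rw [padicNorm.one]) (padicNorm_residue_succ_eq_one hdvd) ht

end Summit.KontsevichZagierPeriods.Zeta5Search.SecondOrder

end
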